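import Summits.Ventures.PercRepro.ProfilePointedCircuitClassesInOutTriangleCross

/-!
# PercRepro — THE SINGLE-TRIANGLE CASE OF `InOutBottomFour` FOR EVERY `ρ ≥ 6`, UNCONDITIONALLY
(p5, gen 39; `proofs/P5-GM1.md` §57)

`inCount_four_le_outCount_five_of_triangle'` (MixedPairHolds) settles the single-triangle case for `ρ ≥ 7`; at
`ρ = 6` (`#E = 10`, the first open size of the conjecture) the assembly of InOutTriangleIV is repeated with the
CROSS comparisons `#D_f ≤ #U_g`, `#D_g ≤ #U_f` of InOutTriangleCross (`mixedTwo_le_mixedFour_cross_of_nine`) in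
place of `(F)_f`, `(F)_g` — the sum `#D_f + #D_g ≤ #U_f + #U_g` is all the assembly uses — and `(G)` from
`mixedPairBottomTopTwo_holds`.

**`inCount_four_le_outCount_five_of_triangle_six`**: on `#E = ρ + 4`, `ρ ≥ 6`, `E − e` without loops or coloops,
`in_4(e) ≤ out_5(e)` at every point `e` whose only circuit with `≤ ρ − 1` elements is a triangle `{e, f, g}`.
-/

open scoped Matroid

namespace PercRepro.Cogirth

open Finset ThmH Skew Shadow Profile

variable {α : Type} [DecidableEq α] {N : Matroid α} [N.Finite]

section TriangleSix

/-- **THE SINGLE-TRIANGLE CASE OF `InOutBottomFour` AT `ρ = 6`** (`#E = 10`): with `E − e` free of loops and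
coloops, at a point `e` with a triangle `{e, f, g}` (`ρ{f, g} = 2`, `e ∈ cl{f, g}`) such that every independent
`4`-subset of `E − e` capturing `e` contains `f` and `g`, `in_4(e) ≤ out_5(e)`. -/
theorem inCount_four_le_outCount_five_of_triangle_of_six
    (hn : (gr N).card = rk N (gr N) + 4) (hR : rk N (gr N) = 6) {e f g : α}
    (he : e ∈ gr N) (hf : f ∈ gr N) (hg : g ∈ gr N) (hef : e ≠ f) (heg : e ≠ g) (hfg : f ≠ g)
    (hnc : rk N ((gr N).erase e) = rk N (gr N))
    (hll : ∀ x ∈ (gr N).erase e, rk N {x} = 1)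
    (hcf : ∀ x ∈ (gr N).erase e, rk N (((gr N).erase e).erase x) = rk N (gr N))
    (hfg2 : rk N {f, g} = 2) (htri : e ∈ clF N {f, g})
    (honly : ∀ X ⊆ (gr N).erase e, X.card + 2 = rk N (gr N) → rk N X = X.card → e ∈ clF N X → f ∈ X ∧ g ∈ X) :
    inCount N 4 e ≤ outCount N 5 e := by
  have hf' : f ∈ (gr N).erase e := mem_erase.2 ⟨hef.symm, hf⟩
  have hg' : g ∈ (gr N).erase e := mem_erase.2 ⟨heg.symm, hg⟩
  have h1 := inCount_four_le_card_demands_of_triangle (N := N) (e := e) (f := f) (g := g) htri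
  have h2 := card_demands_le_of_triangle (N := N) (e := e) hf' hg' hfg
  have h3 := card_units_ge_of_triangle (N := N) (e := e) hf' hg' hfg
  have h4 := card_units_le_outCount_five_of_triangle (N := N) hn he honly
  -- the deletion `M := N ∖ e`
  have hgr : gr (N ＼ ({e} : Set α)) = (gr N).erase e := gr_delete'
  have hrkM : rk (N ＼ ({e} : Set α)) ((gr N).erase e) = rk N (gr N) := by
    rw [rk_delete (M := N) (e := e) (Subset.refl ((gr N).erase e))]
    exact hnc
  have hnM : (gr (N ＼ ({e} : Set α))).card = rk (N ＼ ({e} : Set α)) (gr (N ＼ ({e} : Set α))) + 3 := by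
    rw [hgr, hrkM, card_erase_of_mem he]
    omega
  have h9M : (gr (N ＼ ({e} : Set α))).card = 9 := by
    rw [hgr, card_erase_of_mem he]
    omega
  have hfM : f ∈ gr (N ＼ ({e} : Set α)) := by rw [hgr]; exact hf'
  have hgM : g ∈ gr (N ＼ ({e} : Set α)) := by rw [hgr]; exact hg'
  have hH₀ : (((gr N).erase e).erase f).erase g ⊆ (gr N).erase e := (erase_subset _ _).trans (erase_subset _ _)
  have hsubE : ∀ Y ⊆ (((gr N).erase e).erase f).erase g, Y ⊆ (gr N).erase e := fun Y hY => hY.trans hH₀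
  have hcfM : ∀ x ∈ gr (N ＼ ({e} : Set α)),
      rk (N ＼ ({e} : Set α)) ((gr (N ＼ ({e} : Set α))).erase x) = rk (N ＼ ({e} : Set α)) (gr (N ＼ ({e} : Set α))) := by
    intro x hx
    rw [hgr] at hx
    rw [hgr, rk_delete (M := N) (e := e) (erase_subset _ _), hrkM]
    exact hcf x hx
  -- `(G)` on the deletion
  have hG' := mixedPairBottomTopTwo_holds (N ＼ ({e} : Set α)) f g hfM hgM hfg hnM (by omega)
    (fun x hx => by rw [hgr] at hx; rw [rk_delete (M := N) (e := e) (singleton_subset_iff.2 hx)]; exact hll x hx)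
    hcfM
    (by rw [rk_delete (M := N) (e := e) (insert_subset hf' (singleton_subset_iff.2 hg'))]; exact hfg2)
  rw [hgr] at hG'
  have hGt1 := card_filter_delete_eq (s := ((((gr N).erase e).erase f).erase g).powersetCard 3)
      (P := fun Y => rk (N ＼ ({e} : Set α)) Y = 3 ∧
        rk (N ＼ ({e} : Set α)) ((((gr N).erase e).erase f).erase g \ Y ∪ {f, g}) = ((((gr N).erase e).erase f).erase g \ Y ∪ {f, g}).card)
      (Q := fun Y => rk N Y = 3 ∧
        rk N ((((gr N).erase e).erase f).erase g \ Y ∪ {f, g}) = ((((gr N).erase e).erase f).erase g \ Y ∪ {f, g}).card)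
      (fun Y hY => by
        rw [mem_powersetCard] at hY
        rw [rk_delete (M := N) (e := e) (hsubE Y hY.1),
          rk_delete (M := N) (e := e) (union_subset (sdiff_subset.trans hH₀) (insert_subset hf' (singleton_subset_iff.2 hg')))])
  have hGt2 := card_filter_delete_eq (s := ((((gr N).erase e).erase f).erase g).powersetCard 3)
      (P := fun Y => rk (N ＼ ({e} : Set α)) (Y ∪ {f, g}) = 5 ∧
        rk (N ＼ ({e} : Set α)) ((((gr N).erase e).erase f).erase g \ Y) = ((((gr N).erase e).erase f).erase g \ Y).card)
      (Q := fun Y => rk N (Y ∪ {f, g}) = 5 ∧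
        rk N ((((gr N).erase e).erase f).erase g \ Y) = ((((gr N).erase e).erase f).erase g \ Y).card)
      (fun Y hY => by
        rw [mem_powersetCard] at hY
        rw [rk_delete (M := N) (e := e) (union_subset (hsubE Y hY.1) (insert_subset hf' (singleton_subset_iff.2 hg'))),
          rk_delete (M := N) (e := e) (sdiff_subset.trans hH₀)])
  rw [hGt1, hGt2] at hG'
  -- the CROSS comparisons on the deletion, for `(f, g)` and for `(g, f)`
  have hC1 := mixedTwo_le_mixedFour_cross_of_nine (M := N ＼ ({e} : Set α)) hnM h9M hcfM hfM hgM hfg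
  have hC2 := mixedTwo_le_mixedFour_cross_of_nine (M := N ＼ ({e} : Set α)) hnM h9M hcfM hgM hfM hfg.symm
  rw [hgr] at hC1 hC2
  have hFt1 := card_filter_delete_eq (s := ((((gr N).erase e).erase f).erase g).powersetCard 2)
      (P := fun Y => rk (N ＼ ({e} : Set α)) (insert f Y) = 3 ∧
        rk (N ＼ ({e} : Set α)) (insert g ((((gr N).erase e).erase f).erase g \ Y)) = (insert g ((((gr N).erase e).erase f).erase g \ Y)).card)
      (Q := fun Y => rk N (insert f Y) = 3 ∧
        rk N (insert g ((((gr N).erase e).erase f).erase g \ Y)) = (insert g ((((gr N).erase e).erase f).erase g \ Y)).card)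
      (fun Y hY => by
        rw [mem_powersetCard] at hY
        rw [rk_delete (M := N) (e := e) (insert_subset hf' (hsubE Y hY.1)),
          rk_delete (M := N) (e := e) (insert_subset hg' (sdiff_subset.trans hH₀))])
  have hFt4 := card_filter_delete_eq (s := ((((gr N).erase e).erase f).erase g).powersetCard 4)
      (P := fun Y => rk (N ＼ ({e} : Set α)) (insert g Y) = 5 ∧
        rk (N ＼ ({e} : Set α)) (insert f ((((gr N).erase e).erase f).erase g \ Y)) = (insert f ((((gr N).erase e).erase f).erase g \ Y)).card)
      (Q := fun Y => rk N (insert g Y) = 5 ∧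
        rk N (insert f ((((gr N).erase e).erase f).erase g \ Y)) = (insert f ((((gr N).erase e).erase f).erase g \ Y)).card)
      (fun Y hY => by
        rw [mem_powersetCard] at hY
        rw [rk_delete (M := N) (e := e) (insert_subset hg' (hsubE Y hY.1)),
          rk_delete (M := N) (e := e) (insert_subset hf' (sdiff_subset.trans hH₀))])
  rw [hFt1, hFt4] at hC1
  -- `H₀` for `(g, f)` is `((E − e) − g) − f`, the same set
  have hH₀' : (((gr N).erase e).erase g).erase f = (((gr N).erase e).erase f).erase g := by
    ext a; simp only [mem_erase]; tauto
  rw [hH₀'] at hC2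
  have hFt3 := card_filter_delete_eq (s := ((((gr N).erase e).erase f).erase g).powersetCard 2)
      (P := fun Y => rk (N ＼ ({e} : Set α)) (insert g Y) = 3 ∧
        rk (N ＼ ({e} : Set α)) (insert f ((((gr N).erase e).erase f).erase g \ Y)) = (insert f ((((gr N).erase e).erase f).erase g \ Y)).card)
      (Q := fun Y => rk N (insert g Y) = 3 ∧
        rk N (insert f ((((gr N).erase e).erase f).erase g \ Y)) = (insert f ((((gr N).erase e).erase f).erase g \ Y)).card)
      (fun Y hY => by
        rw [mem_powersetCard] at hY
        rw [rk_delete (M := N) (e := e) (insert_subset hg' (hsubE Y hY.1)),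
          rk_delete (M := N) (e := e) (insert_subset hf' (sdiff_subset.trans hH₀))])
  have hFt2 := card_filter_delete_eq (s := ((((gr N).erase e).erase f).erase g).powersetCard 4)
      (P := fun Y => rk (N ＼ ({e} : Set α)) (insert f Y) = 5 ∧
        rk (N ＼ ({e} : Set α)) (insert g ((((gr N).erase e).erase f).erase g \ Y)) = (insert g ((((gr N).erase e).erase f).erase g \ Y)).card)
      (Q := fun Y => rk N (insert f Y) = 5 ∧
        rk N (insert g ((((gr N).erase e).erase f).erase g \ Y)) = (insert g ((((gr N).erase e).erase f).erase g \ Y)).card)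
      (fun Y hY => by
        rw [mem_powersetCard] at hY
        rw [rk_delete (M := N) (e := e) (insert_subset hf' (hsubE Y hY.1)),
          rk_delete (M := N) (e := e) (insert_subset hg' (sdiff_subset.trans hH₀))])
  rw [hFt3, hFt2] at hC2
  omega

/-- **THE SINGLE-TRIANGLE CASE OF `InOutBottomFour`, UNCONDITIONALLY, FOR EVERY `ρ ≥ 6`**: on `#E = ρ(E) + 4`,
`ρ(E) ≥ 6`, with `E − e` free of loops and coloops, at a point `e` with a triangle `{e, f, g}` (`ρ{f, g} = 2`,
`e ∈ cl{f, g}`) such that every independent `(ρ − 2)`-subset of `E − e` capturing `e` contains `f` and `g`,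
`in_4(e) ≤ out_5(e)`. -/
theorem inCount_four_le_outCount_five_of_triangle_six
    (hn : (gr N).card = rk N (gr N) + 4) (hR : 6 ≤ rk N (gr N)) {e f g : α}
    (he : e ∈ gr N) (hf : f ∈ gr N) (hg : g ∈ gr N) (hef : e ≠ f) (heg : e ≠ g) (hfg : f ≠ g)
    (hnc : rk N ((gr N).erase e) = rk N (gr N))
    (hll : ∀ x ∈ (gr N).erase e, rk N {x} = 1)
    (hcf : ∀ x ∈ (gr N).erase e, rk N (((gr N).erase e).erase x) = rk N (gr N))
    (hfg2 : rk N {f, g} = 2) (htri : e ∈ clF N {f, g})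
    (honly : ∀ X ⊆ (gr N).erase e, X.card + 2 = rk N (gr N) → rk N X = X.card → e ∈ clF N X → f ∈ X ∧ g ∈ X) :
    inCount N 4 e ≤ outCount N 5 e := by
  rcases Nat.lt_or_ge (rk N (gr N)) 7 with h | h
  · exact inCount_four_le_outCount_five_of_triangle_of_six hn (by omega) he hf hg hef heg hfg hnc hll hcf hfg2
      htri honly
  · exact inCount_four_le_outCount_five_of_triangle' hn h he hf hg hef heg hfg hnc hll hcf hfg2 htri honly

end TriangleSix

end PercRepro.Cogirth
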